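/-
Copyright (c) 2026 the pub-hodgecm-mathlib formalisation cell (harness21).  Prover seat hodgecm-mathlib-LH5-p04 (g9); G-rows dealer ∕ reader F0P3a-p09 (g13) (LEAD F0P3a-plan
T14-67 rule 20 ∕ T14-69 (1)); G-ROW LEDGER v4 row «(G3)-RAM-TAME» (first-in-line 23:24:09Z, trigger (G3) ★ 23:5xZ); the tame-ramified twin of ★ (G3) `F0P3cStCharTSEPGlueG`
(LH10-p02 (g12)), re-lettered over ★ EULER-G-RAM (p852968), ★ P2-RAM (p852982) ∕ ★ C₃-RAM (P3 ED. 2, F0P2-p02), ★ (T2)-RAM (F0P2-p02), ★ (G0)-RAM (LH1-p01); 2026-09-03.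
-/
import Summits.HodgeConjecture.HodgeConjecture.Theorems.F0P3cStCharTSEPGlueGRamifiedCore  -- FILE A (this seat): §0 (T1) at any uniformiser, §1 sign, §2 CM (N)-RAM head; brings ★ (G3)'s imports
import Literature.NumberTheory.Automorphic.UnitaryLatticeTreeEulerRelationRamified          -- ★ p852968 EULER-G-RAM (this seat): `natCard_fixedBy_add_eq_natCard_fixedBy_inf_add_one_three_of_neg`
import Literature.NumberTheory.Rogawski1990.UnitaryVertexStabilizerSpanSelfDualTameRamifiedCM  -- ★ `ramifiedBlock_adicCompletion` (the tame block `(ϖ, hϖ, hσϖ, hres, hnorm)` at `e(w|v) ≠ 1`, `|2|_w = 1`)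
import HarnessLib

/-!
# F0 · P3c · line LH6 «StCharTS» — «(G3)-RAM», FILE B (head): KOTTWITZ'S EULER–POINCARÉ FUNCTION ON `G_v = U(Φ₃)(L⁺_v)` AT A TAMELY RAMIFIED PLACE
# [Kottwitz1988 §2 Thm. 2; Rogawski1990 §12.6; Tits1979 §2.4 (the ramified quasi-split `²A₂`: local index `(q+1, q+1)`)]

Cell `pub/hodgecm-mathlib`, crux H413 = `stmt-HodgeConjecture-24833` (lane `--kind proof --supports … --as helper`), route HCCMUnconditional; seat LH5-p04 (g9), «(G3)-RAM-TAME»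
first-in-line by the G-row dealer F0P3a-p09 (g13) (23:24:09Z ∕ 23:31:58Z ∕ 23:49:26Z: (a) (T1)-RAM + (c) sign + (d) CM (N)-RAM head INSIDE this file; (b) indices = ★ LH1-p01's
`index_inf_subgroupOf_eq_of_ramified`).  THEOREMS ONLY (no definition ∕ instance ∕ notation ∕ named fact ∕ `sorry`); ★-only imports.

WHAT.  The tame-ramified twin of ★ (G3) `F0P3cStCharTSEPGlueG.exists_epFunction_G`: for a CM field `L`, a finite place `v` of `L⁺` that is non-split AND RAMIFIED in `L`
(`w ∣ v`, `e(w|v) ≠ 1`) of ODD residue characteristic (`|2|_w = 1`), every Haar measure `νQv` on `G_v = U(Φ₃)(L⁺_v)` and every family `mQv` canonical for (`IsRegularElt`, `νQv`),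
there is `f_G ∈ C_c^∞(G_v)` — `f_G := νQv(K₀)⁻¹𝟙_{K₀} + νQv(K₁)⁻¹𝟙_{K₁} − νQv(I)⁻¹𝟙_I` for the two (special) vertex stabilisers `K₀, K₁` and the Iwahori `I = K₀ ⊓ K₁` of the
`(q+1)`-regular lattice tree of `U(3)` at `w`, pulled back along ★ `localNonsplitEquiv` — measurable, integrable, of MASS ONE, with `f_G(1)` REAL NEGATIVE, canonical orbital integral `1`
at every regular class with COMPACT centraliser and `0` at every regular class with NON-compact centraliser.  SAME conclusion shape as ★ (G3) (eight clauses, in order), so the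
★ (G4)∕(G5) consumers `obtain` it identically at a tame ramified place.

HOW (re-lettering of ★ (G3), row by row).  Tame block `(ϖ, |ϖ| = exp(−1), σ_w ϖ = −ϖ, hres, hnorm)` from ★ `ramifiedBlock_adicCompletion (he) (h2w)`; (E) `hE` := ★ EULER-G-RAM
`natCard_fixedBy_add_eq_natCard_fixedBy_inf_add_one_three_of_neg`; (N) `hN` := §2 `epNonEllipticCombination_eq_zero_three_of_neg` (the CM head of ★ P3 re-lettered over ★ C₃-RAM
`epCombination_classOrbitalIntegral_eq_zero_of_latticeModel_three_of_neg`, translation `e τ = diag(ϖ⁻¹, 1, σ_w ϖ)`), with (T1) := §0 (★ (G3) §0 with the uniformiser of `L_w` in place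
of `ι_w ϖ_v` — at a ramified `w`, `|ι_w ϖ_v| = |ϖ|²`) and (T2) := ★ (T2)-RAM `exists_splitTorus_generator_local_of_nonsplit_three_of_involution`; value at one: ★ (G0)-RAM indices
`[K₀ : I] = [K₁ : I] = q + 1` (`index_inf_subgroupOf_eq_of_ramified`, `q = |𝓀_w|`) + ★ `measureReal_coe_eq_index_mul` + §1 `epValueAtOne_neg_of_ramified`
(`νQv(K₀)⁻¹ + νQv(K₁)⁻¹ − νQv(I)⁻¹ = νQv(I)⁻¹(2∕(q+1) − 1) < 0` since `q ≥ 2`); ★ GLUE `…_of_relations_congr'` and ★ `classOrbitalIntegral_epCombination_eq(_of_compactSpace)` unchanged.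

* (FILE A `F0P3cStCharTSEPGlueGRamifiedCore`) §0 `exists_conj_coe_localNonsplitEquiv_eq_diagonal_of_not_isCompact_centralizer_of_v` — (T1) for ANY `ϖ ∈ L_w` with `|ϖ| = exp(−1)` (no `hunr`).
* §1 `epValueAtOne_neg_of_ramified` — the sign of `a⁻¹ + b⁻¹ − m⁻¹` for `a = b = (q+1)·m`, `q ≥ 2` (the `(q+1, q+1)` twin of ★ (G7) `epValueAtOne_eq_and_neg`).
* §2 `epNonEllipticCombination_eq_zero_three_of_neg` — the CM (N)-RAM head (★ P3's CM head with `hd ↦` tame block, `hτm` third slot `σ_w ϖ`).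
* §3 **`exists_epFunction_G_of_ramified`** — the head.
HONEST LABEL: count-neutral helper (UNPROVED 16 unchanged; it widens the EP-G column — K1∕K2′∕POS-ONE instances at `St(ψ)`∕`ψ∘det` — to TAME RAMIFIED places, instances only at t1′;
WILD∕dyadic ramified places stay OPEN, census G-RAM §4); h413 OPEN; HC_CM is proved only modulo the 7 printed citations (2 remaining named inputs: hLiu418 =
`stmt-HodgeConjecture-24832`, h413 = `stmt-HodgeConjecture-24833`) until rung 0 closes.

## References
* [Kottwitz1988] R. E. Kottwitz, *Tamagawa numbers*, Ann. of Math. 127 (1988), §2 Theorem 2 (Euler–Poincaré functions on a rank-one group; `Φ(γ, f_EP) = χ(𝒯^γ)`).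
* [Rogawski1990] J. D. Rogawski, *Automorphic Representations of Unitary Groups in Three Variables* (1990), §12.6 p. 187 (pseudo-coefficients), §12.3 p. 176, §3.6 pp. 28–31.
* [Tits1979] J. Tits, *Reductive groups over local fields*, PSPM 33.1 (1979), §2.4 (local index `(q+1, q+1)` of the ramified `²A₂`), §3.5, §3.9.
* [Serre1980Trees] J.-P. Serre, *Trees* (1980), II.1.1–1.3.
* [Laumon1995] G. Laumon, *Cohomology of Drinfeld Modular Varieties* I (1996), Lemma (5.3.2) p. 136.
-/

set_option autoImplicit false
-- the mandated namespace has the single-problem summit's repeated segment (`HodgeConjecture.HodgeConjecture`)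
set_option linter.dupNamespace false

noncomputable section

open NumberField IsDedekindDomain MeasureTheory Topology
open scoped Matrix MatrixGroups Valued
open Literature.NumberTheory.Rogawski1990 Literature.NumberTheory.Automorphic Literature.NumberTheory.Automorphic.UnitaryGroup
open Literature.NumberTheory.GaloisRepresentations
open Summit.HodgeConjecture.HodgeConjecture.Cruxes.H413.F0P3cStCharTSTorusDefs
open Summit.HodgeConjecture.HodgeConjecture.Cruxes.H413.F0P3cStCharTSEPGlueG

namespace Summit.HodgeConjecture.HodgeConjecture.Cruxes.H413.F0P3cStCharTSEPGlueGRamified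

variable (L : Type) [Field L] [NumberField L] [IsCMField L] (v : HeightOneSpectrum (𝓞 ↥(maximalRealSubfield L)))

/-! ## §3 Kottwitz's Euler–Poincaré function on `U(Φ₃)(L⁺_v)` at a tame ramified place -/

set_option maxHeartbeats 1600000 in  -- statement-level `whnf` on the CM carriers + five clauses, as in the ★ H-side twin `F0P3cStCharTSEllMassHEP.exists_epFunction_H`
/-- **(G3) «EP-G»: KOTTWITZ'S EULER–POINCARÉ FUNCTION ON `G_v = U(Φ₃)(L⁺_v)`** (`v` non-split and TAMELY RAMIFIED in `L`: `e(w|v) ≠ 1`, `|2|_w = 1`): for every Haar measure `νQv` and every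
family `mQv` canonical for (`IsRegularElt`, `νQv`) there is `f_G : G_v → ℂ`, locally constant with compact support, measurable, integrable, with `∫ f_G dνQv = 1`, whose value at `1`
is the REAL NEGATIVE number `νQv(K₀)⁻¹ + νQv(K₁)⁻¹ − νQv(I)⁻¹` (★ (G7)), and whose canonical orbital integral is `1` at every regular class with COMPACT centraliser and `0` at every
regular class with NON-compact centraliser (`f_G := νQv(K₀)⁻¹𝟙_{K₀} + νQv(K₁)⁻¹𝟙_{K₁} − νQv(I)⁻¹𝟙_I`, `K₀`∕`K₁` the two vertex stabilisers and `I` the Iwahori of the `U(3)` tree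
pulled back along ★ `localNonsplitEquiv`).  EP inputs BY NAME: ★ `classOrbitalIntegral_epCombination_eq(_of_compactSpace)`, ★ (G0)-RAM `index_inf_subgroupOf_eq_of_ramified`, ★ EULER-G-RAM, §2 (N)-RAM over ★ C₃-RAM (kit binders (T1) := §0, (T2) := ★ `exists_splitTorus_generator_local_of_nonsplit_three_of_involution`), the tame block ★ `ramifiedBlock_adicCompletion`.
[cite: Kottwitz1988, §2 Theorem 2] [cite: Rogawski1990, §12.6 p. 187] [cite: Tits1979, §2.4] [cite: Serre1980Trees, II.1.1] -/
theorem exists_epFunction_G_of_ramified (hns : ∀ w : PlacesOver L v, IsCMField.complexConj L • w.1 = w.1)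
    (w : PlacesOver L v) (he : v.asIdeal.ramificationIdx' w.1.asIdeal ≠ 1) (h2w : Valued.v (2 : w.1.adicCompletion L) = 1)
    [MeasurableSpace (Gqs L v)] [BorelSpace (Gqs L v)]
    [∀ γ : Gqs L v, MeasurableSpace (Gqs L v ⧸ Subgroup.centralizer ({γ} : Set (Gqs L v)))]
    [∀ γ : Gqs L v, BorelSpace (Gqs L v ⧸ Subgroup.centralizer ({γ} : Set (Gqs L v)))]
    (νQv : Measure (Gqs L v)) [νQv.IsHaarMeasure] [νQv.IsMulRightInvariant]
    {mQv : OrbitalMeasureFamily (Gqs L v)}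
    (hcanQ : mQv.IsCanonical (fun γ => IsRegularElt (γ.val : GL (Fin 3) (UnitaryGroup.LocalRing L v))) νQv) :
    ∃ fG : Gqs L v → ℂ, IsLocSmooth fG ∧ Measurable fG ∧ Integrable fG νQv ∧ ∫ g, fG g ∂νQv = 1 ∧
      (fG 1).im = 0 ∧ (fG 1).re < 0 ∧
      (∀ γ : Gqs L v, IsRegularElt (γ.val : GL (Fin 3) (UnitaryGroup.LocalRing L v)) →
        IsCompact ((Subgroup.centralizer ({γ} : Set (Gqs L v))) : Set (Gqs L v)) → classOrbitalIntegral mQv fG (ConjClasses.mk γ) = 1) ∧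
      (∀ γ : Gqs L v, IsRegularElt (γ.val : GL (Fin 3) (UnitaryGroup.LocalRing L v)) →
        ¬ IsCompact ((Subgroup.centralizer ({γ} : Set (Gqs L v))) : Set (Gqs L v)) → classOrbitalIntegral mQv fG (ConjClasses.mk γ) = 0) := by
  classical
  have hw : IsCMField.complexConj L • w.1 = w.1 := hns w
  have hc1 : IsCMField.complexConj L ≠ 1 := IsCMField.complexConj_ne_one L
  haveI : Algebra.IsQuadraticExtension ↥(maximalRealSubfield L) L := IsCMField.isQuadraticExtension L
  have hHf : ((qsForm L).map (cmConjRingHom L))ᵀ = qsForm L := UnitaryGroup.antidiagOne_isHermitian L 3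
  have hdetf : (qsForm L).det ≠ 0 := (UnitaryGroup.isUnit_antidiagOne_det L 3).ne_zero
  set σ := galAdicCompletionMap (L := L) (IsCMField.complexConj L) hw with hσdef
  -- the unramified datum at `w` and the one-place model
  obtain ⟨ϖ, hϖv, hσϖ, hres, hnorm⟩ := ramifiedBlock_adicCompletion L v w hw he h2w
  have hσσ : ∀ x : w.1.adicCompletion L, σ (σ x) = x := galAdicCompletionMap_galAdicCompletionMap_of_smul_eq (IsCMField.complexConj L) w hc1 hw
  have hvσ : ∀ x : w.1.adicCompletion L, Valued.v (σ x) = Valued.v x := fun x => valued_galAdicCompletionMap (L := L) (IsCMField.complexConj L) hw x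
  set eU := localNonsplitEquiv (IsCMField.complexConj L) (qsForm L) hc1 w hw with heUdef
  -- the three levels, pulled back to `G_v`
  have hϖ0 : ϖ ≠ 0 := fun h0 => by have hv := hϖv; rw [h0, map_zero] at hv; exact WithZero.zero_ne_coe hv
  set g₁ : GL (Fin 3) (w.1.adicCompletion L) :=
    glDiagonal 3 (w.1.adicCompletion L) ![1, 1, Units.mk0 ϖ hϖ0] with hg₁def
  have hg₁ : (g₁ : Matrix (Fin 3) (Fin 3) (w.1.adicCompletion L)) = Matrix.diagonal ![(1 : w.1.adicCompletion L), 1, ϖ] := by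
    rw [hg₁def, coe_glDiagonal]
    congr 1
    funext i
    fin_cases i <;> rfl
  -- re-read the one-place model on the literal form `Φ₃ = antidiag(1,1,1)` (★ EULER-G ∕ (G1) ∕ (G0) currency)
  have hJw : placeForm (qsForm L) w.1 = (StdForm.antidiagonal 3).over (w.1.adicCompletion L) := by
    rw [placeForm, qsForm, antidiagOne_eq_over, StdForm.over_map]
  set UA := unitaryGroupOfForm σ ((StdForm.antidiagonal 3).over (w.1.adicCompletion L)) with hUAdef
  obtain ⟨eA, heA⟩ : ∃ eA : Gqs L v ≃ₜ* ↥UA, ∀ g : Gqs L v, ((eA g : ↥UA) : GL (Fin 3) (w.1.adicCompletion L)) =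
      ((eU g : ↥(unitaryGroupOfForm σ (placeForm (qsForm L) w.1))) : GL (Fin 3) (w.1.adicCompletion L)) := by
    rw [hUAdef, ← hJw]
    exact ⟨eU, fun g => rfl⟩
  haveI hTG : IsTopologicalGroup ↥UA := inferInstance
  set K0w : Subgroup ↥UA := (glInt 3 (w.1.adicCompletion L)).subgroupOf UA with hK0wdef
  set K1w : Subgroup ↥UA := ((glInt 3 (w.1.adicCompletion L)).map (MulAut.conj g₁).toMonoidHom).subgroupOf UA with hK1wdef
  set K0 : Subgroup (Gqs L v) := K0w.comap eA.toMulEquiv.toMonoidHom with hK0def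
  set K1 : Subgroup (Gqs L v) := K1w.comap eA.toMulEquiv.toMonoidHom with hK1def
  set I : Subgroup (Gqs L v) := (K0w ⊓ K1w).comap eA.toMulEquiv.toMonoidHom with hIdef
  -- compact-open (★ (G0) §2 on `UA`, pulled back along the homeomorphism `eA`)
  have hσc : Continuous σ := continuous_galAdicCompletionMap L (IsCMField.complexConj L) hw
  haveI := compactSpace_integer_adicCompletion L w.1
  have hpre : ∀ C : Subgroup ↥UA, ((C.comap eA.toMulEquiv.toMonoidHom : Subgroup (Gqs L v)) : Set (Gqs L v)) = eA ⁻¹' (C : Set ↥UA) := fun _ => rfl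
  have hK0o : IsOpen (K0 : Set (Gqs L v)) := by
    rw [hK0def, hpre]; exact (UnitaryLatticeTree.isOpen_glInt_subgroupOf σ _).preimage eA.continuous
  have hK0c : IsCompact (K0 : Set (Gqs L v)) := by
    rw [hK0def, hpre]; exact eA.toHomeomorph.isCompact_preimage.2 (UnitaryLatticeTree.isCompact_glInt_subgroupOf σ _ hσc)
  have hK1o : IsOpen (K1 : Set (Gqs L v)) := by
    rw [hK1def, hpre]; exact (UnitaryLatticeTree.isOpen_conj_glInt_subgroupOf σ _ g₁).preimage eA.continuous
  have hK1c : IsCompact (K1 : Set (Gqs L v)) := by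
    rw [hK1def, hpre]; exact eA.toHomeomorph.isCompact_preimage.2 (UnitaryLatticeTree.isCompact_conj_glInt_subgroupOf σ _ g₁ hσc)
  have hIo : IsOpen (I : Set (Gqs L v)) := by
    rw [hIdef, hpre]; exact (UnitaryLatticeTree.isOpen_glInt_inf_conj_glInt_subgroupOf σ _ g₁).preimage eA.continuous
  have hIc : IsCompact (I : Set (Gqs L v)) := by
    rw [hIdef, hpre]; exact eA.toHomeomorph.isCompact_preimage.2 (UnitaryLatticeTree.isCompact_glInt_inf_conj_glInt_subgroupOf σ _ g₁ hσc)
  -- volumes of compact open subgroups are finite and positive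
  have hvol : ∀ S : Subgroup (Gqs L v), IsOpen (S : Set (Gqs L v)) → IsCompact (S : Set (Gqs L v)) → (((νQv S).toReal : ℂ)) ≠ 0 := by
    intro S hSo hSc
    have hpos : 0 < νQv S := hSo.measure_pos νQv ⟨1, S.one_mem⟩
    exact_mod_cast (ENNReal.toReal_pos hpos.ne' hSc.measure_lt_top.ne).ne'
  have hint : ∀ S : Subgroup (Gqs L v), IsOpen (S : Set (Gqs L v)) → IsCompact (S : Set (Gqs L v)) → ∀ c : ℂ,
      Integrable (fun g => c * (S : Set (Gqs L v)).indicator (fun _ => (1 : ℂ)) g) νQv := fun S hSo hSc c =>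
    (((isLocSmooth_indicator_subgroup S hSo hSc).continuous.integrable_of_hasCompactSupport
      (isLocSmooth_indicator_subgroup S hSo hSc).hasCompactSupport)).const_mul c
  have hintv : ∀ S : Subgroup (Gqs L v), IsOpen (S : Set (Gqs L v)) → ∀ c : ℂ,
      ∫ g, c * (S : Set (Gqs L v)).indicator (fun _ => (1 : ℂ)) g ∂νQv = c * ((νQv S).toReal : ℂ) := by
    intro S hSo c
    rw [integral_const_mul, integral_indicator_const (1 : ℂ) hSo.measurableSet, Complex.real_smul, mul_one]
    rfl
  -- Kottwitz's function
  set fG : Gqs L v → ℂ := fun g => (((νQv K0).toReal : ℂ))⁻¹ * (K0 : Set (Gqs L v)).indicator (fun _ => (1 : ℂ)) g +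
      (((νQv K1).toReal : ℂ))⁻¹ * (K1 : Set (Gqs L v)).indicator (fun _ => (1 : ℂ)) g -
      (((νQv I).toReal : ℂ))⁻¹ * (I : Set (Gqs L v)).indicator (fun _ => (1 : ℂ)) g with hfGdef
  have hsmooth : IsLocSmooth fG := isLocSmooth_epCombination K0 K1 I hK0o hK0c hK1o hK1c hIo hIc _ _ _
  have iK0 := hint K0 hK0o hK0c ((((νQv K0).toReal : ℂ))⁻¹)
  have iK1 := hint K1 hK1o hK1c ((((νQv K1).toReal : ℂ))⁻¹)
  have iI := hint I hIo hIc ((((νQv I).toReal : ℂ))⁻¹)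
  have hfG1 : fG 1 = (((νQv K0).toReal : ℂ))⁻¹ + (((νQv K1).toReal : ℂ))⁻¹ - (((νQv I).toReal : ℂ))⁻¹ := by
    simp only [hfGdef, Set.indicator_of_mem (SetLike.mem_coe.2 K0.one_mem), Set.indicator_of_mem (SetLike.mem_coe.2 K1.one_mem),
      Set.indicator_of_mem (SetLike.mem_coe.2 I.one_mem), mul_one]
  have hfG1re : (fG 1).re = ((νQv K0).toReal)⁻¹ + ((νQv K1).toReal)⁻¹ - ((νQv I).toReal)⁻¹ := by
    rw [hfG1, ← Complex.ofReal_inv, ← Complex.ofReal_inv, ← Complex.ofReal_inv, ← Complex.ofReal_add, ← Complex.ofReal_sub, Complex.ofReal_re]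
  refine ⟨fG, hsmooth, hsmooth.continuous.measurable, (iK0.add iK1).sub iI, ?_, ?_, ?_, ?_, ?_⟩
  · -- mass one
    have h1 : ∫ g, fG g ∂νQv = (∫ g, (((νQv K0).toReal : ℂ))⁻¹ * (K0 : Set (Gqs L v)).indicator (fun _ => (1 : ℂ)) g ∂νQv +
        ∫ g, (((νQv K1).toReal : ℂ))⁻¹ * (K1 : Set (Gqs L v)).indicator (fun _ => (1 : ℂ)) g ∂νQv) -
        ∫ g, (((νQv I).toReal : ℂ))⁻¹ * (I : Set (Gqs L v)).indicator (fun _ => (1 : ℂ)) g ∂νQv := by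
      have h := integral_sub (μ := νQv)
        (f := fun g => (((νQv K0).toReal : ℂ))⁻¹ * (K0 : Set (Gqs L v)).indicator (fun _ => (1 : ℂ)) g +
          (((νQv K1).toReal : ℂ))⁻¹ * (K1 : Set (Gqs L v)).indicator (fun _ => (1 : ℂ)) g)
        (g := fun g => (((νQv I).toReal : ℂ))⁻¹ * (I : Set (Gqs L v)).indicator (fun _ => (1 : ℂ)) g) (iK0.add iK1) iI
      rw [integral_add iK0 iK1] at h
      exact h
    rw [h1, hintv K0 hK0o, hintv K1 hK1o, hintv I hIo, inv_mul_cancel₀ (hvol K0 hK0o hK0c), inv_mul_cancel₀ (hvol K1 hK1o hK1c),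
      inv_mul_cancel₀ (hvol I hIo hIc)]
    norm_num
  · -- `fG 1` is real
    rw [hfG1, ← Complex.ofReal_inv, ← Complex.ofReal_inv, ← Complex.ofReal_inv, ← Complex.ofReal_add, ← Complex.ofReal_sub, Complex.ofReal_im]
  · -- `fG 1 < 0` (from the tame-ramified indices `q + 1`, `q + 1` of ★ `index_inf_subgroupOf_eq_of_ramified` ((G0)-RAM, LH1-p01), transported along `eA`; §1 sign lemma)
    letI : Fintype 𝓀[w.1.adicCompletion L] := Fintype.ofFinite _
    have hidx := UnitaryLatticeTree.index_inf_subgroupOf_eq_of_ramified hσσ hvσ hσϖ hϖv hres h2w hnorm g₁ hg₁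
    have h0 : (I.subgroupOf K0).index = Nat.card 𝓀[w.1.adicCompletion L] + 1 := by
      rw [hIdef, hK0def, index_subgroupOf_comap_mulEquiv]; exact hidx.1
    have h1 : (I.subgroupOf K1).index = Nat.card 𝓀[w.1.adicCompletion L] + 1 := by
      rw [hIdef, hK1def, index_subgroupOf_comap_mulEquiv]; exact hidx.2
    haveI : (I.subgroupOf K0).FiniteIndex := ⟨by rw [h0]; exact Nat.succ_ne_zero _⟩
    haveI : (I.subgroupOf K1).FiniteIndex := ⟨by rw [h1]; exact Nat.succ_ne_zero _⟩
    have hq2 : 2 ≤ Nat.card 𝓀[w.1.adicCompletion L] := Finite.one_lt_card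
    have hmpos : 0 < (νQv I).toReal :=
      ENNReal.toReal_pos (hIo.measure_pos νQv ⟨1, I.one_mem⟩).ne' hIc.measure_lt_top.ne
    have ha : (νQv K0).toReal = ((Nat.card 𝓀[w.1.adicCompletion L] : ℝ) + 1) * (νQv I).toReal := by
      have h := UnitaryLatticeTree.measureReal_coe_eq_index_mul νQv (Subgroup.comap_mono inf_le_left : I ≤ K0) hIo
      rw [h0, measureReal_def, measureReal_def] at h
      rw [h]; push_cast; ring
    have hb : (νQv K1).toReal = ((Nat.card 𝓀[w.1.adicCompletion L] : ℝ) + 1) * (νQv I).toReal := by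
      have h := UnitaryLatticeTree.measureReal_coe_eq_index_mul νQv (Subgroup.comap_mono inf_le_right : I ≤ K1) hIo
      rw [h1, measureReal_def, measureReal_def] at h
      rw [h]; push_cast; ring
    rw [hfG1re]
    exact epValueAtOne_neg_of_ramified hmpos hq2 ha hb
  · -- elliptic regular classes: (E) = ★ EULER-G-RAM on `UA`, finiteness from the compact centraliser and the closed regular class, counts transported along `eA`
    intro γ hreg hZc
    haveI : CompactSpace (Subgroup.centralizer ({γ} : Set (Gqs L v))) := isCompact_iff_compactSpace.1 hZc
    have hO := UnitaryGroup.isClosed_conjClass_local_of_isRegularElt L 3 (qsForm L) v hHf hdetf γ hreg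
    -- finiteness of the fixed sets, proved on `G_v` and moved to `UA`
    have hfin : ∀ C : Subgroup ↥UA, IsOpen ((C.comap eA.toMulEquiv.toMonoidHom : Subgroup (Gqs L v)) : Set (Gqs L v)) →
        IsCompact ((C.comap eA.toMulEquiv.toMonoidHom : Subgroup (Gqs L v)) : Set (Gqs L v)) → (MulAction.fixedBy (↥UA ⧸ C) (eA γ)).Finite := by
      intro C hCo hCc
      haveI := (finite_fixedBy_quotient_of_isClosed γ (C.comap eA.toMulEquiv.toMonoidHom) hO hCo hCc).to_subtype
      obtain ⟨Φ, -⟩ := exists_equiv_fixedBy_quotient_congr (C.comap eA.toMulEquiv.toMonoidHom) C eA.toMulEquiv (fun g => Iff.rfl) γ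
      exact Set.finite_coe_iff.1 (Finite.of_equiv _ Φ)
    -- the centraliser of `eA γ` in `UA` is the (compact) image of `Z(γ)`
    have hZeq : ((Subgroup.centralizer ({eA γ} : Set ↥UA)) : Set ↥UA) = eA '' ((Subgroup.centralizer ({γ} : Set (Gqs L v))) : Set (Gqs L v)) := by
      ext u
      simp only [SetLike.mem_coe, Subgroup.mem_centralizer_singleton_iff, Set.mem_image]
      constructor
      · intro hu
        refine ⟨eA.symm u, ?_, eA.apply_symm_apply u⟩
        apply eA.injective
        rw [map_mul, map_mul, eA.apply_symm_apply]
        exact hu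
      · rintro ⟨g, hg, rfl⟩
        rw [← map_mul, ← map_mul, hg]
    have hZc' : IsCompact ((Subgroup.centralizer ({eA γ} : Set ↥UA)) : Set ↥UA) := by
      rw [hZeq]; exact hZc.image eA.continuous
    haveI : CompactSpace (Subgroup.centralizer ({eA γ} : Set ↥UA)) := isCompact_iff_compactSpace.1 hZc'
    have hK0wo : IsOpen (K0w : Set ↥UA) := by
      rw [hK0wdef]; exact UnitaryLatticeTree.isOpen_glInt_subgroupOf σ ((StdForm.antidiagonal 3).over (w.1.adicCompletion L))
    have horb := finite_range_pow_quotient_of_isOpen (G := ↥UA) (eA γ) K0w hK0wo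
    have hE := UnitaryLatticeTree.natCard_fixedBy_add_eq_natCard_fixedBy_inf_add_one_three_of_neg hσσ hvσ hϖv hσϖ hres h2w hnorm g₁ hg₁ (eA γ) (hfin K0w hK0o hK0c) (hfin K1w hK1o hK1c) horb
    rw [hfGdef, classOrbitalIntegral_epCombination_eq_of_compactSpace L 3 (qsForm L) v νQv hHf hdetf hcanQ K0 K1 I hK0o hK0c hK1o hK1c hIo hIc γ hreg,
      natCard_fixedBy_quotient_congr K0 K0w eA.toMulEquiv (fun g => Iff.rfl) γ, natCard_fixedBy_quotient_congr K1 K1w eA.toMulEquiv (fun g => Iff.rfl) γ,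
      natCard_fixedBy_quotient_congr I (K0w ⊓ K1w) eA.toMulEquiv (fun g => Iff.rfl) γ]
    have hE' : (Nat.card (MulAction.fixedBy (↥UA ⧸ K0w) (eA.toMulEquiv γ)) : ℂ) + (Nat.card (MulAction.fixedBy (↥UA ⧸ K1w) (eA.toMulEquiv γ)) : ℂ) =
        (Nat.card (MulAction.fixedBy (↥UA ⧸ (K0w ⊓ K1w)) (eA.toMulEquiv γ)) : ℂ) + 1 := by exact_mod_cast hE
    rw [hE', add_sub_cancel_left]
  · -- non-elliptic regular classes: (N) = §2 `epNonEllipticCombination_eq_zero_three_of_neg` (★ C₃-RAM), kit binders (T1) := §0 and (T2) := ★ (T2)-RAM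
    intro γ hreg hZnc
    have hnc : ¬ CompactSpace (Subgroup.centralizer ({γ} : Set (Gqs L v))) := fun h => hZnc (isCompact_iff_compactSpace.2 h)
    -- the three levels by membership through `eU`
    have hmem : ∀ (C : Subgroup (GL (Fin 3) (w.1.adicCompletion L))) (g : Gqs L v),
        g ∈ ((C.subgroupOf UA).comap eA.toMulEquiv.toMonoidHom : Subgroup (Gqs L v)) ↔
          ((eU g : ↥(unitaryGroupOfForm σ (placeForm (qsForm L) w.1))) : GL (Fin 3) (w.1.adicCompletion L)) ∈ C := by
      intro C g
      rw [Subgroup.mem_comap, Subgroup.mem_subgroupOf, ← heA g]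
      rfl
    have hImem : ∀ g : Gqs L v, g ∈ I ↔
        ((eU g : ↥(unitaryGroupOfForm σ (placeForm (qsForm L) w.1))) : GL (Fin 3) (w.1.adicCompletion L)) ∈ glInt 3 (w.1.adicCompletion L) ∧
          ((eU g : ↥(unitaryGroupOfForm σ (placeForm (qsForm L) w.1))) : GL (Fin 3) (w.1.adicCompletion L)) ∈
            (glInt 3 (w.1.adicCompletion L)).map (MulAut.conj g₁).toMonoidHom := by
      intro g
      rw [hIdef, Subgroup.mem_comap, Subgroup.mem_inf, hK0wdef, hK1wdef, Subgroup.mem_subgroupOf, Subgroup.mem_subgroupOf, ← heA g]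
      rfl
    -- the antidiagonal shape of `(Φ₃)_w`
    have hform := TypeThreeTorus.placeForm_qsForm_eq L w
    have hJ : ∀ i j : Fin 3, j ≠ Fin.rev i → placeForm (qsForm L) w.1 i j = 0 := by
      intro i j hij
      rw [hform]
      fin_cases i <;> fin_cases j <;> first | rfl | exact absurd (by decide) hij
    have hH₀₂ : placeForm (qsForm L) w.1 0 2 ≠ 0 := by rw [hform]; exact one_ne_zero
    have hH₁₁ : placeForm (qsForm L) w.1 1 1 ≠ 0 := by rw [hform]; exact one_ne_zero
    -- (T1) := §0 at the uniformiser `ϖ` of `L_w` (`σ_w ϖ = −ϖ`)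
    have hT1 : ∀ γ : Gqs L v, IsRegularElt (γ.val : GL (Fin 3) (UnitaryGroup.LocalRing L v)) →
        ¬ CompactSpace (Subgroup.centralizer ({γ} : Set (Gqs L v))) →
        ∃ (g : Gqs L v) (e : Fin 3 → w.1.adicCompletion L) (c : ℤ),
          (((eU (g * γ * g⁻¹) : ↥(unitaryGroupOfForm σ (placeForm (qsForm L) w.1))) : GL (Fin 3) (w.1.adicCompletion L)) :
              Matrix (Fin 3) (Fin 3) (w.1.adicCompletion L)) = Matrix.diagonal e ∧
            Valued.v (e 0) = Valued.v (ϖ ^ c) ∧ Valued.v (e 1) = 1 ∧ Valued.v (e 2) = Valued.v (ϖ ^ (-c)) := by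
      intro γ hreg hncs
      have hnc' : ¬ IsCompact ((Subgroup.centralizer ({γ} : Set (Gqs L v))) : Set (Gqs L v)) := fun h => hncs (isCompact_iff_compactSpace.1 h)
      obtain ⟨γ', d, c, hconj, hm, -, hv0, hv1, hv2⟩ :=
        exists_conj_coe_localNonsplitEquiv_eq_diagonal_of_not_isCompact_centralizer_of_v L v hns w hw hϖv hreg hnc'
      obtain ⟨g, hg⟩ := isConj_iff.1 hconj
      exact ⟨g, d, c, by rw [hg]; exact hm, hv0, hv1, hv2⟩
    -- (T2) := ★ (T2)-RAM `exists_splitTorus_generator_local_of_nonsplit_three_of_involution` (F0P2-p02; regularity of the diagonal from the separable characteristic polynomial)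
    have hT2 : ∀ δ : Gqs L v, IsRegularElt (δ.val : GL (Fin 3) (UnitaryGroup.LocalRing L v)) →
        (∃ e : Fin 3 → w.1.adicCompletion L,
          (((eU δ : ↥(unitaryGroupOfForm σ (placeForm (qsForm L) w.1))) : GL (Fin 3) (w.1.adicCompletion L)) :
              Matrix (Fin 3) (Fin 3) (w.1.adicCompletion L)) = Matrix.diagonal e) →
        ∃ τ : Subgroup.centralizer ({δ} : Set (Gqs L v)),
          (((eU (τ : Gqs L v) : ↥(unitaryGroupOfForm σ (placeForm (qsForm L) w.1))) : GL (Fin 3) (w.1.adicCompletion L)) :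
              Matrix (Fin 3) (Fin 3) (w.1.adicCompletion L)) = Matrix.diagonal ![ϖ⁻¹, 1, σ ϖ] ∧
          (∀ c' : Subgroup.centralizer ({δ} : Set (Gqs L v)), ∃ n : ℤ, c' * (τ ^ n)⁻¹ ∈ compactCore (Subgroup.centralizer ({δ} : Set (Gqs L v)))) ∧
          (∀ n : ℤ, τ ^ n ∈ compactCore (Subgroup.centralizer ({δ} : Set (Gqs L v))) → n = 0) := by
      rintro δ hregδ ⟨e, hδm⟩
      haveI := isDiscreteValuationRing_integer_of_compatible hϖv
      have hsep : (Matrix.diagonal e).charpoly.Separable := by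
        rw [← hδm]; exact (TypeThreeTorus.isRegularElt_iff_separable_localNonsplitEquiv L w hw _).1 hregδ
      have hinj : Function.Injective e := by
        rw [Matrix.charpoly_diagonal] at hsep; exact Polynomial.separable_prod_X_sub_C_iff.1 hsep
      exact exists_splitTorus_generator_local_of_nonsplit_three_of_involution (IsCMField.complexConj L) (qsForm L) hc1 w hw hJ hH₀₂ hH₁₁
        (isUniformizingElement_of_v_eq hϖv) hδm (fun i j hij => isUnit_iff_ne_zero.2 (sub_ne_zero.2 fun h => hij (hinj h)))
    -- `Φ(ν(C)⁻¹ · 𝟙_C) = ν(C)⁻¹ · Φ(𝟙_C)` ×3 (★ linearity at a regular class), then the ★ assembly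
    rw [hfGdef, classOrbitalIntegral_epCombination_eq L 3 (qsForm L) v hHf hdetf hcanQ.isAdmissibleOn K0 K1 I hK0o hK0c hK1o hK1c hIo hIc _ _ _ γ hreg]
    exact epNonEllipticCombination_eq_zero_three_of_neg L w hw νQv hcanQ hϖv hσϖ hres h2w hnorm g₁ hg₁ K0 K1 I (hmem _) (hmem _) hImem hK0o hK0c hK1o hK1c hIo hIc
      hT1 hT2 γ hreg hnc

end Summit.HodgeConjecture.HodgeConjecture.Cruxes.H413.F0P3cStCharTSEPGlueGRamified

end
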